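import Summits.HubbardSuperconductivity.HubbardSuperconductivity.Theses.SpinOnePairBoson
import Summits.HubbardSuperconductivity.HubbardSuperconductivity.Theorems.TwTipContinuation.Negative.TipNormalForm
import HarnessLib

/-!
# Crux `SopContinuation` (stmt-HubbardSuperconductivity-2254; route `SpinOnePairBoson`, rank 5 "the bet")
— BIRTH SKELETON `Lines/birth.lean` (BC3)

THE CRUX (fixed; `Theses/SpinOnePairBoson.lean`, decl `SopContinuation`, not restated here): for ALL
cluster shapes `a × b` with `2/(ab) ∈ (0,1/2)`, all symmetric intra-cluster hopping patterns `τ` and all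
`U > 0` — IF the cluster-modulated Hubbard tori `H_L(τ,t',U)` (hopping `τ` on bonds inside an `a × b`
cluster `{⌊x₀/a⌋, ⌊x₁/b⌋ fixed}`, hopping `t'` on bonds between clusters, on-site `U`) have, for every
small `t' ∈ (0,t₀)`, EVERY-ground-state `d_{x²-y²}` pair-field order `c(t') L⁴ ≤ Re⟨ψ, Δ_d†Δ_d ψ⟩` in
the `(N_L = 2⌊(1 - 2/(ab))L²/2⌋, S^z = 0)` sector (one hole pair per cluster) on all large tori with
`2a ∣ L`, `2b ∣ L` (the ANCHOR shape of `SopAnchorOrder`), THEN the summit's matrix holds at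
`(U, δ = 2/(ab))`: every admissible sequence of normalised sector ground states of the UNIFORM model
`hubbardTorus 2 L 1 U = H_L(1,1,U)` has `HasLongRangeOrder` of
`torusPullback (pairFieldCorr dWaveFormFactor ψ)` along the even sides `2k`.

THE LINE = the crux's own stated content ("(1) no quantum phase transition along (τ,t') → (1,1) at
fixed (U,δ); (2) removal of the `2a ∣ L, 2b ∣ L` artefact at the uniform point; pointwise-to-liminf
bookkeeping"), cut at its natural joints, with (1) further split by a REGIME DICHOTOMY at the decoupled
point `t' = 0`. Write (TU) for: "the DECOUPLED cluster torus `H_L(τ,0,U)` has a unique (up to phase)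
ground state in the summit's sector `(N_L, S^z = 0)` on every large cluster-commensurate torus". The
bookkeeping piece is ALREADY A TREE THEOREM and is used by name, not stubbed.

1. `stub_uniqueDecoupledDark` — THE OFF-DESIGN REGIME IS DARK: (TU) ⇒ the anchor premise FAILS (so the
   crux holds there vacuously, by refuting its hypothesis — any proof of the crux must consume the
   premise, cf. the sibling crux `TwTipContinuation`'s `not_abstractTipShape`). Mechanism (gapped
   product-state stability): on a torus with `≥ 2ab` clusters, (TU) forces (i) the cluster ground state
   at charge `ab - 2` to be a unique singlet and (ii) `ab - 2` to be an EXPOSED point of the cluster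
   staircase `N ↦ E(N)` (otherwise a finite rearrangement of cluster charges `p·(N₁) + q·(N₂)`,
   `p + q ≤ 2ab`, ties or lowers the energy), so `H_L(τ,0,U) - μN̂` has a unique PRODUCT ground state
   with an `L`-uniform gap; stability of gapped commuting/frustration-free Hamiltonians with LTQO
   (trivial for product states) under extensive finite-range EVEN fermionic perturbations
   (Bravyi–Hastings–Michalakis arXiv:1001.0344; Michalakis–Zwolak arXiv:1109.1588; for lattice
   fermions Nachtergaele–Sims–Young arXiv:1705.08553, De Roeck–Salmhofer arXiv:1712.00977; classical-
   reference-state expansions Kennedy–Tasaki 1992, Datta–Fernández–Fröhlich 1996, Yarotsky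
   arXiv:math-ph/0412040) gives, for `|t'| < t₀` UNIFORMLY in `L`, a unique gapped ground state of
   `H_L(τ,t',U) - μN̂`, which by `U(1) × U(1)` symmetry and continuity lies in, and is the unique
   ground state of, the sector `(N_L, 0)`; exponential clustering (Hastings–Koma arXiv:math-ph/0507008)
   then caps `Re⟨Δ_d†Δ_d⟩ = Σ_{x,y} ⟨d_x† d_y⟩` (fixed `N`: `⟨d_y⟩ = 0`) at `O(L²) < c L⁴`. So for
   every `t₀` the premise's order claim fails at all small `t'`. Why it might fail: only through the
   hypotheses of the fermionic stability theorem (uniform LOCAL gap from exposedness, even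
   perturbations, LTQO) — a formalisation-sized risk, not a physical one. Size: L (no stability
   machinery in the tree).
2. `stub_degenerateBet` — THE BET on the design locus `¬(TU)` (degenerate decoupled ground manifold:
   the route's flat pair staircase `SopFlatClusterPoint` is exactly this case — the product manifold
   `{0,1,2 pairs}^clusters` — as are spinful or charge-tied clusters): anchor premise ⇒ an eventual,
   uniform, EVERY-ground-state bound `c L⁴ ≤ Re⟨ψ, Δ_d†Δ_d ψ⟩` for the UNIFORM model
   `hubbardTorus 2 L 1 U` in the `(2⌊(1 - 2/(ab))L²/2⌋, S^z = 0)` sector on the commensurate tori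
   `2a ∣ L`, `2b ∣ L`. Content: absence of a ground-state phase transition along a path
   `(τ(s), t'(s))` from `(τ, small t')` to `(1,1)` at fixed `(U, δ = 2/(ab))` — the adiabatic
   continuity of the modulated `d`-wave superconductor to the uniform one (Tsai–Kivelson 2006
   conjecture; DCA: `d`-SC continuous in `t'`, maximal at `t' = 1`, Doluweera et al. 2008; CDMFT,
   Chakraborty–Sénéchal–Tremblay 2011). MODEL-TYPED on the Hubbard family (the abstract shape "lit at
   small coupling ⇒ lit at the endpoint" is false by level crossing: sibling
   `Theorems/TwTipContinuation/Negative/AbstractTipShapeFalse.lean: not_abstractTipShape`), premise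
   every-GS and consumed. Why it might fail: the crux's own — typed over ALL `(a,b,τ,U)`; one modulated
   family ordering at small `t'` at a `(U, 2/(ab))` where the uniform model lacks `d`-wave LRO
   falsifies it (4×4 designs end at `δ = 1/8`, `U ≈ 8`, inside `PureModelStripeCompetition`, Qin et
   al. 2020, Xu et al. 2024; 2×4 ends at `δ = 1/4`, unsettled); gapless phase, no continuation tool.
   Size: crux-sized (the residual of the crux).
3. `stub_evenSides` — REMOVAL OF THE COMMENSURABILITY ARTEFACT at the uniform point, general period
   `m` (applied with `m = ab`: `2ab ∣ L ⇒ 2a ∣ L ∧ 2b ∣ L`): an eventual uniform every-GS order bound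
   for `hubbardTorus 2 L 1 U` along `L ∈ 2mℕ` gives one along ALL even `L` (possibly smaller constant,
   later threshold). At the uniform point no cluster structure remains, so both sides express
   infinite-volume `d`-wave LRO at `(U,δ)`; but finite-size spectra of a nodal `d`-wave state depend on
   `L mod 2m` (momentum grid vs. nodal directions, Paramekanti–Randeria–Trivedi cond-mat/0305611), so
   this is a genuine thermodynamic-limit statement (comparison of tori of different sides; no tool in
   tree). Same shape as the registered `stub_evenSides` of the sibling skeleton
   `Cruxes/PbContinuation/Lines/birth.lean` (period 4 there). Why it might fail: an `L mod 2m` anomaly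
   of the every-GS bound surviving `L → ∞` (no known mechanism at `δ > 0`). Size: M–L.
4. (NOT A STUB — landed) `Summit.HubbardSuperconductivity.TwTipContinuation.Negative.summitMatrix_of_everyGSOrder`
   (`Theorems/TwTipContinuation/Negative/TipNormalForm.lean`): an eventual uniform every-GS bound along
   even `L` gives the summit's matrix at `(U,δ)`; its converse `everyGSOrder_of_summitMatrix` is also
   landed, so piece 3's conclusion is EQUIVALENT to the crux's conclusion at `(U, 2/(ab))` — the cut
   loses nothing.

COMPOSITION `SopContinuation_of : SopContinuation` (harness skeleton convention A12: concludes the crux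
BY NAME, no hypotheses, cites the declared stubs by name; no `sorry` outside the stubs): for
`a b τ U hU hδ hτ` and the anchor hypothesis `hA`: `0 < ab` from `0 < 2/(ab)` (the junk value
`2/0 = 0` is excluded by the crux's own hypothesis); `Classical.em (TU)`: (TU) ⇒
`(stub_uniqueDecoupledDark … hTU hA).elim`, ¬(TU) ⇒ `stub_degenerateBet … hTU hA` = commensurate every-GS
order; restrict it to `2ab ∣ L` (`dvd_trans`), feed `stub_evenSides U (2/(ab)) (ab)`, finish with
`summitMatrix_of_everyGSOrder` at `δ = 2/(ab)`. Read with the stubs abstracted this is the pure-logic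
implication `stub₁-sig → stub₂-sig → stub₃-sig → SopContinuation`.

DISPROOF USED: no `Cruxes/SopContinuation/Disproof.lean`, no `Theorems/SopContinuation/Negative/`, no
earlier `Lines/` (2026-08-17; `ledger crux ls stmt-HubbardSuperconductivity-2254`: no workfiles, no
ideas). Honoured from the sibling continuation cruxes: `TwTipContinuation`'s `not_abstractTipShape` /
`UniformRungsShapeFalse` (the model-free continuation shape is false ⇒ stub 2 is typed on the Hubbard
family and keeps the every-GS premise load-bearing; stub 1 is the regime where the premise is
refuted rather than transported); `PbContinuation/Lines/birth.lean` (registered two-stub cut; this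
skeleton adds the decoupled-point dichotomy). `ledger negatives --problem HubbardSuperconductivity`
(2026-08-17, 2 entries: stmt-1180 `BreathingSelfDual`, the `L = 2` artefact of the breathing family;
stmt-1314 `KlsOrderOpenness`, openness of KLS order under arbitrary small spin perturbations): no stub
is an instance — stub 1 transports a GAP (not an order), stubs 2–3 are eventual-in-`L` statements
about `hubbardTorus`.

BC3 AUDIT (planner folder `bc/`, farm `lean check --json`): this file rc 0, `sorries = 3` = the three
stubs (warnings only `declaration uses sorry` at `stub_uniqueDecoupledDark`, `stub_degenerateBet`,
`stub_evenSides`; zero elsewhere; file audit: `SopContinuation_of` proof-of-item for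
`SpinOnePairBoson.SopContinuation`, not closed: axioms [sorryAx]). PROBES (files
`bc/SopContinuation_probe_stub{1,2,3}.lean`, this file NOT imported, hypothesis = the stub signature
verbatim, one `example` per tactic alternative with `maxHeartbeats 400000`): `stub → SopContinuation`
and `stub → HubbardSuperconductivity` for each of the three stubs, each by `exact?`, `simpa`,
`simpa [target]`, `unfold target; simpa`, `aesop`, `intro; unfold; aesop` — all FAIL (see the
evidence file `BC3-SopContinuation.md` on the item for the per-probe messages); positive controls
`stub → stub` elaborate. No stub is cheaply the crux or the summit.

Sources: Tsai–Kivelson PRB 73 (2006) 214510; Tsai–Yao–Läuchli–Kivelson PRB 77 (2008) 214502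
(arXiv:0803.0933); Doluweera et al. PRB 78 (2008) 020504 (doi:10.1103/physrevb.78.020504);
Chakraborty–Sénéchal–Tremblay PRB 84 (2011) 054545; Qin et al. PRX 10 (2020) 031016; Bravyi–Hastings–
Michalakis J. Math. Phys. 51 (2010) 093512 (arXiv:1001.0344); Michalakis–Zwolak CMP 322 (2013) 277
(arXiv:1109.1588); Nachtergaele–Sims–Young, Contemp. Math. 717 (2018) (arXiv:1705.08553); De Roeck–
Salmhofer CMP 365 (2019) 773 (arXiv:1712.00977); Hastings–Koma CMP 265 (2006) 781
(arXiv:math-ph/0507008); Kennedy–Tasaki CMP 147 (1992) 431; Datta–Fernández–Fröhlich J. Stat. Phys. 84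
(1996) 455; Yarotsky CMP 261 (2006) 799 (arXiv:math-ph/0412040); Paramekanti–Randeria–Trivedi PRB 70
(2004) 054504 (cond-mat/0305611); Scalapino, Phys. Rep. 250 (1995) 329 §2. No definition is introduced;
all statements are over existing declarations.
-/

noncomputable section

-- `dupNamespace`: the summit and the problem are both named `HubbardSuperconductivity` (layout D-0022)
set_option linter.dupNamespace false

namespace Summit.HubbardSuperconductivity.HubbardSuperconductivity.Cruxes.SopContinuation.Birth

open Matrix Filter
open Literature.Probability.LatticeModels Literature.MathematicalPhysics.QuantumLattice
open Summit.HubbardSuperconductivity.HubbardSuperconductivity.Theses.SpinOnePairBoson (SopContinuation)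
open Summit.HubbardSuperconductivity.TwTipContinuation.Negative (summitMatrix_of_everyGSOrder)

/-! ## The three stubs -/

/-- **STUB 1 `stub_uniqueDecoupledDark` — THE OFF-DESIGN REGIME IS DARK.** For all `a b τ U` of the
crux: if (TU) the DECOUPLED cluster torus `H_L(τ,0,U)` has a unique ground state in the sector
`(N_L, S^z = 0)` on every large torus with `2a ∣ L`, `2b ∣ L`, then the anchor premise of the crux
(every-GS `d`-wave order `c(t') L⁴ ≤ Re⟨ψ, Δ_d†Δ_d ψ⟩` of `H_L(τ,t',U)` for ALL small `t'`) is FALSE: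
(TU) makes `ab - 2` an exposed point of the cluster staircase and the cluster ground state a unique
singlet, so `H_L(τ,0,U) - μN̂` has a unique product ground state with an `L`-uniform gap; gapped
product-state stability under the extensive even fermionic perturbation `t'·V` (Bravyi–Hastings–
Michalakis arXiv:1001.0344, Michalakis–Zwolak arXiv:1109.1588, Nachtergaele–Sims–Young
arXiv:1705.08553, De Roeck–Salmhofer arXiv:1712.00977) keeps the sector ground state unique and
gapped for `|t'| < t₀` uniformly in `L`, and exponential clustering (Hastings–Koma
arXiv:math-ph/0507008) caps `Re⟨Δ_d†Δ_d⟩` at `O(L²)`. Size L. -/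
theorem stub_uniqueDecoupledDark :
    ∀ (a b : ℕ) (τ : ℕ × ℕ → ℕ × ℕ → ℝ) (U : ℝ), 0 < U →
      (2 : ℝ) / ((a : ℝ) * (b : ℝ)) ∈ Set.Ioo (0:ℝ) (1 / 2) → (∀ p q, τ p q = τ q p) →
      -- (TU) the DECOUPLED cluster torus `H_L(τ,0,U)` has a unique ground state in the summit's
      -- sector `(N_L, S^z = 0)` on every large cluster-commensurate torus
      (∃ L₀ : ℕ, ∀ (L : ℕ) [NeZero L], L₀ ≤ L → 2 * a ∣ L → 2 * b ∣ L →
        ∀ (N : ℕ), N = 2 * ⌊(1 - (2 : ℝ) / ((a : ℝ) * (b : ℝ))) * (L : ℝ) ^ 2 / 2⌋₊ →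
        ∀ (ψ ψ' : Fock (Orb (FermionTorus 2 L))),
          IsGroundStateInSector (-(∑ x : FermionTorus 2 L, ∑ y : FermionTorus 2 L, ∑ σ : Fin 2,
              (((if (fermionTorusGraph 2 L).Adj x y then
                  (if ((ofLex x) 0 : ℕ) / a = ((ofLex y) 0 : ℕ) / a ∧ ((ofLex x) 1 : ℕ) / b = ((ofLex y) 1 : ℕ) / b
                    then τ (((ofLex x) 0 : ℕ) % a, ((ofLex x) 1 : ℕ) % b) (((ofLex y) 0 : ℕ) % a, ((ofLex y) 1 : ℕ) % b)
                    else 0)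
                else 0 : ℝ)) : ℂ) • (creation (orb x σ) * annihilation (orb y σ))) +
              (U : ℂ) • ∑ x : FermionTorus 2 L, numberOp x 0 * numberOp x 1) N 0 ψ →
          IsGroundStateInSector (-(∑ x : FermionTorus 2 L, ∑ y : FermionTorus 2 L, ∑ σ : Fin 2,
              (((if (fermionTorusGraph 2 L).Adj x y then
                  (if ((ofLex x) 0 : ℕ) / a = ((ofLex y) 0 : ℕ) / a ∧ ((ofLex x) 1 : ℕ) / b = ((ofLex y) 1 : ℕ) / b
                    then τ (((ofLex x) 0 : ℕ) % a, ((ofLex x) 1 : ℕ) % b) (((ofLex y) 0 : ℕ) % a, ((ofLex y) 1 : ℕ) % b)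
                    else 0)
                else 0 : ℝ)) : ℂ) • (creation (orb x σ) * annihilation (orb y σ))) +
              (U : ℂ) • ∑ x : FermionTorus 2 L, numberOp x 0 * numberOp x 1) N 0 ψ' →
          ∃ z : ℂ, ψ' = z • ψ) →
      -- then the anchor premise of the crux (every-GS d-wave order at ALL small t') FAILS
      ¬ (∃ t₀ : ℝ, 0 < t₀ ∧ ∀ t' ∈ Set.Ioo (0:ℝ) t₀, ∃ c : ℝ, 0 < c ∧ ∃ L₀ : ℕ, ∀ (L : ℕ) [NeZero L],
          L₀ ≤ L → 2 * a ∣ L → 2 * b ∣ L → ∀ (N : ℕ) (ψ : Fock (Orb (FermionTorus 2 L))),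
          N = 2 * ⌊(1 - (2 : ℝ) / ((a : ℝ) * (b : ℝ))) * (L : ℝ) ^ 2 / 2⌋₊ → star ψ ⬝ᵥ ψ = 1 →
          IsGroundStateInSector (-(∑ x : FermionTorus 2 L, ∑ y : FermionTorus 2 L, ∑ σ : Fin 2,
              (((if (fermionTorusGraph 2 L).Adj x y then
                  (if ((ofLex x) 0 : ℕ) / a = ((ofLex y) 0 : ℕ) / a ∧ ((ofLex x) 1 : ℕ) / b = ((ofLex y) 1 : ℕ) / b
                    then τ (((ofLex x) 0 : ℕ) % a, ((ofLex x) 1 : ℕ) % b) (((ofLex y) 0 : ℕ) % a, ((ofLex y) 1 : ℕ) % b)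
                    else t')
                else 0 : ℝ)) : ℂ) • (creation (orb x σ) * annihilation (orb y σ))) +
              (U : ℂ) • ∑ x : FermionTorus 2 L, numberOp x 0 * numberOp x 1) N 0 ψ →
          c * (L : ℝ) ^ 4 ≤
            (expect (Matrix.conjTranspose (pairField dWaveFormFactor L) * pairField dWaveFormFactor L) ψ).re) := by
  sorry

/-- **STUB 2 `stub_degenerateBet` — THE BET on the design locus `¬(TU)`.** For all `a b τ U` of the
crux whose decoupled cluster torus is DEGENERATE in the summit's sector along arbitrarily large
commensurate tori (flat pair staircases — the route's `SopFlatClusterPoint` —, spinful or charge-tied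
clusters): the anchor premise (verbatim) implies an eventual, uniform, EVERY-ground-state bound
`c L⁴ ≤ Re⟨ψ, Δ_d†Δ_d ψ⟩` for the UNIFORM model `hubbardTorus 2 L 1 U` in the
`(2⌊(1 - 2/(ab))L²/2⌋, S^z = 0)` sector on the tori `2a ∣ L`, `2b ∣ L`. Content: no ground-state phase
transition along `(τ,t') → (1,1)` at fixed `(U, δ = 2/(ab))` (Tsai–Kivelson 2006; DCA Doluweera et
al. 2008; CDMFT Chakraborty–Sénéchal–Tremblay 2011). Model-typed (the abstract continuation shape is
false, `not_abstractTipShape`); the residual of the crux, with the crux's own why-might-fail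
(`PureModelStripeCompetition` at the 4×4, `δ = 1/8` designs; Qin et al. 2020). Size: crux-sized. -/
theorem stub_degenerateBet :
    ∀ (a b : ℕ) (τ : ℕ × ℕ → ℕ × ℕ → ℝ) (U : ℝ), 0 < U →
      (2 : ℝ) / ((a : ℝ) * (b : ℝ)) ∈ Set.Ioo (0:ℝ) (1 / 2) → (∀ p q, τ p q = τ q p) →
      -- (¬TU) the decoupled cluster torus is DEGENERATE in the summit's sector along arbitrarily
      -- large cluster-commensurate tori (flat staircases, charge ties, spinful clusters, …)
      ¬ (∃ L₀ : ℕ, ∀ (L : ℕ) [NeZero L], L₀ ≤ L → 2 * a ∣ L → 2 * b ∣ L →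
        ∀ (N : ℕ), N = 2 * ⌊(1 - (2 : ℝ) / ((a : ℝ) * (b : ℝ))) * (L : ℝ) ^ 2 / 2⌋₊ →
        ∀ (ψ ψ' : Fock (Orb (FermionTorus 2 L))),
          IsGroundStateInSector (-(∑ x : FermionTorus 2 L, ∑ y : FermionTorus 2 L, ∑ σ : Fin 2,
              (((if (fermionTorusGraph 2 L).Adj x y then
                  (if ((ofLex x) 0 : ℕ) / a = ((ofLex y) 0 : ℕ) / a ∧ ((ofLex x) 1 : ℕ) / b = ((ofLex y) 1 : ℕ) / b
                    then τ (((ofLex x) 0 : ℕ) % a, ((ofLex x) 1 : ℕ) % b) (((ofLex y) 0 : ℕ) % a, ((ofLex y) 1 : ℕ) % b)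
                    else 0)
                else 0 : ℝ)) : ℂ) • (creation (orb x σ) * annihilation (orb y σ))) +
              (U : ℂ) • ∑ x : FermionTorus 2 L, numberOp x 0 * numberOp x 1) N 0 ψ →
          IsGroundStateInSector (-(∑ x : FermionTorus 2 L, ∑ y : FermionTorus 2 L, ∑ σ : Fin 2,
              (((if (fermionTorusGraph 2 L).Adj x y then
                  (if ((ofLex x) 0 : ℕ) / a = ((ofLex y) 0 : ℕ) / a ∧ ((ofLex x) 1 : ℕ) / b = ((ofLex y) 1 : ℕ) / b
                    then τ (((ofLex x) 0 : ℕ) % a, ((ofLex x) 1 : ℕ) % b) (((ofLex y) 0 : ℕ) % a, ((ofLex y) 1 : ℕ) % b)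
                    else 0)
                else 0 : ℝ)) : ℂ) • (creation (orb x σ) * annihilation (orb y σ))) +
              (U : ℂ) • ∑ x : FermionTorus 2 L, numberOp x 0 * numberOp x 1) N 0 ψ' →
          ∃ z : ℂ, ψ' = z • ψ) →
      -- the anchor premise of the crux, verbatim
      (∃ t₀ : ℝ, 0 < t₀ ∧ ∀ t' ∈ Set.Ioo (0:ℝ) t₀, ∃ c : ℝ, 0 < c ∧ ∃ L₀ : ℕ, ∀ (L : ℕ) [NeZero L],
          L₀ ≤ L → 2 * a ∣ L → 2 * b ∣ L → ∀ (N : ℕ) (ψ : Fock (Orb (FermionTorus 2 L))),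
          N = 2 * ⌊(1 - (2 : ℝ) / ((a : ℝ) * (b : ℝ))) * (L : ℝ) ^ 2 / 2⌋₊ → star ψ ⬝ᵥ ψ = 1 →
          IsGroundStateInSector (-(∑ x : FermionTorus 2 L, ∑ y : FermionTorus 2 L, ∑ σ : Fin 2,
              (((if (fermionTorusGraph 2 L).Adj x y then
                  (if ((ofLex x) 0 : ℕ) / a = ((ofLex y) 0 : ℕ) / a ∧ ((ofLex x) 1 : ℕ) / b = ((ofLex y) 1 : ℕ) / b
                    then τ (((ofLex x) 0 : ℕ) % a, ((ofLex x) 1 : ℕ) % b) (((ofLex y) 0 : ℕ) % a, ((ofLex y) 1 : ℕ) % b)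
                    else t')
                else 0 : ℝ)) : ℂ) • (creation (orb x σ) * annihilation (orb y σ))) +
              (U : ℂ) • ∑ x : FermionTorus 2 L, numberOp x 0 * numberOp x 1) N 0 ψ →
          c * (L : ℝ) ^ 4 ≤
            (expect (Matrix.conjTranspose (pairField dWaveFormFactor L) * pairField dWaveFormFactor L) ψ).re) →
      -- then: eventual uniform every-GS d-wave order of the UNIFORM model on the commensurate tori
      ∃ c : ℝ, 0 < c ∧ ∃ L₀ : ℕ, ∀ (L : ℕ) [NeZero L], L₀ ≤ L → 2 * a ∣ L → 2 * b ∣ L →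
        ∀ ψ : Fock (Orb (FermionTorus 2 L)), star ψ ⬝ᵥ ψ = 1 →
          IsGroundStateInSector (hubbardTorus 2 L 1 U)
              (2 * ⌊(1 - (2 : ℝ) / ((a : ℝ) * (b : ℝ))) * (L : ℝ) ^ 2 / 2⌋₊) 0 ψ →
            c * (L : ℝ) ^ 4 ≤
              (expect ((pairField dWaveFormFactor L)ᴴ * pairField dWaveFormFactor L) ψ).re := by
  sorry

/-- **STUB 3 `stub_evenSides` — REMOVAL OF THE COMMENSURABILITY ARTEFACT at the uniform point**
(general period `m > 0`; used with `m = ab`). For `U > 0`, `δ ∈ (0,1/2)`: an eventual uniform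
every-GS `d`-wave order bound for `hubbardTorus 2 L 1 U` in the `(2⌊(1-δ)L²/2⌋, S^z = 0)` sector along
`L ∈ 2mℕ` gives one along ALL even `L`. A genuine thermodynamic-limit statement (finite-size spectra
of a nodal `d`-wave state depend on `L mod 2m`, Paramekanti–Randeria–Trivedi cond-mat/0305611; no
torus-comparison tool in the tree); same shape as the registered period-4 stub of
`Cruxes/PbContinuation/Lines/birth.lean`. Size: M–L. -/
theorem stub_evenSides :
    ∀ (U δ : ℝ) (m : ℕ), 0 < U → δ ∈ Set.Ioo (0:ℝ) (1 / 2) → 0 < m →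
      (∃ c : ℝ, 0 < c ∧ ∃ L₀ : ℕ, ∀ (L : ℕ) [NeZero L], L₀ ≤ L → 2 * m ∣ L →
        ∀ ψ : Fock (Orb (FermionTorus 2 L)), star ψ ⬝ᵥ ψ = 1 →
          IsGroundStateInSector (hubbardTorus 2 L 1 U) (2 * ⌊(1 - δ) * (L : ℝ) ^ 2 / 2⌋₊) 0 ψ →
            c * (L : ℝ) ^ 4 ≤
              (expect ((pairField dWaveFormFactor L)ᴴ * pairField dWaveFormFactor L) ψ).re) →
      ∃ c : ℝ, 0 < c ∧ ∃ L₀ : ℕ, ∀ (L : ℕ) [NeZero L], L₀ ≤ L → Even L →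
        ∀ ψ : Fock (Orb (FermionTorus 2 L)), star ψ ⬝ᵥ ψ = 1 →
          IsGroundStateInSector (hubbardTorus 2 L 1 U) (2 * ⌊(1 - δ) * (L : ℝ) ^ 2 / 2⌋₊) 0 ψ →
            c * (L : ℝ) ^ 4 ≤
              (expect ((pairField dWaveFormFactor L)ᴴ * pairField dWaveFormFactor L) ψ).re := by
  sorry

/-! ## The composition: the three stubs and the landed bookkeeping theorem prove the crux BY NAME -/

/-- **`SopContinuation` from the three stubs** (A12 skeleton convention: concludes the route decl
`SpinOnePairBoson.SopContinuation` BY NAME, no hypotheses, cites the stubs by name; no `sorry` here):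
`0 < ab` from the crux's `0 < 2/(ab)`; `Classical.em (TU)` — dark regime (stub 1 refutes the premise)
or the bet (stub 2); restriction to `2ab ∣ L`; artefact removal (stub 3, `m = ab`); bookkeeping by the
landed `summitMatrix_of_everyGSOrder` at `δ = 2/(ab)`. [folklore] -/
theorem SopContinuation_of : SopContinuation := by
  intro a b τ U hU hδ hτ hA
  -- `a·b > 0` from `0 < 2/(ab)` (else `2/0 = 0`)
  have hab : 0 < a * b := by
    rcases Nat.eq_zero_or_pos (a * b) with h0 | hpos
    · exfalso
      have h1 : (0 : ℝ) < 2 / ((a : ℝ) * (b : ℝ)) := hδ.1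
      rw [← Nat.cast_mul, h0, Nat.cast_zero, div_zero] at h1
      exact lt_irrefl 0 h1
    · exact hpos
  -- regime split on (TU): dark-by-stability (premise refuted) or the bet
  have h1 := (Classical.em _).elim
    (fun hTU => ((stub_uniqueDecoupledDark a b τ U hU hδ hτ hTU) hA).elim)
    (fun hTU => stub_degenerateBet a b τ U hU hδ hτ hTU hA)
  obtain ⟨c, hc, L₀, hL⟩ := h1
  -- commensurability removal with period `m = ab` (`2ab ∣ L ⇒ 2a ∣ L ∧ 2b ∣ L`), then bookkeeping
  refine summitMatrix_of_everyGSOrder (stub_evenSides U _ (a * b) hU hδ hab ⟨c, hc, L₀, ?_⟩)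
  intro L _ hL₀ hdiv ψ hψ hgs
  exact hL L hL₀ (dvd_trans (Dvd.intro b (by ring)) hdiv) (dvd_trans (Dvd.intro a (by ring)) hdiv) ψ hψ hgs

end Summit.HubbardSuperconductivity.HubbardSuperconductivity.Cruxes.SopContinuation.Birth

end
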